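import Literature.Probability.RandomPlanarGeometry.PlaneNonIntersection
import HarnessLib

/-!
# Non-intersecting pairs of planar walks: the elementary bounds `0 < N(k) ≤ 16^k`

Proof-only companion (theorems only; no definition, no named fact) to `PlaneNonIntersection.lean`,
which vendors the Lawler–Schramm–Werner display
`c⁻¹ k^{-5/8} ≤ P[S[0,k] ∩ S'[0,k] = ∅] ≤ c k^{-5/8}` (Acta Math. 187 (2001), §1, the display after
Thm. 1) as the named fact `LSW2001_srw_nonIntersection_five_eighths`, with the probability written
as `nonIntersectingPairs k / 16^k`.

What is proved here is the part of the transposition that is elementary, i.e. that the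
normalisation and the object are the intended ones:

* `mem_box_of_walk_origin`, `mem_box_of_walk_e₁`, `sum_card_walks_from_origin`,
  `sum_card_walks_from_e₁` — a `k`-step nearest-neighbour walk from `0` (resp. `e₁ = (1,0)`) ends
  in `{-k,…,k}²` (resp. `{-(k+1),…,k+1}²`), and there are exactly `4^k` `k`-step walks from `0` and
  `4^k` from `e₁`, all captured by those boxes: the endpoint sums of `nonIntersectingPairs` are
  exhaustive;
* `sum_card_pairs` — hence the number of ordered pairs summed over is `16^k`, so that
  `nonIntersectingPairs k / 16^k` IS the probability under the uniform law on pairs of `k`-step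
  walks (= the law of two independent simple random walks run for `k` steps);
* `nonIntersectingPairs_eq_card_filter` — `N(k)` is the cardinality of the set of such pairs with
  disjoint vertex sets (the quadruple sum of indicators, re-read as `#(filter …)`);
* `nonIntersectingPairs_le`, `nonIntersectingPairs_div_le_one` — `N(k) ≤ 16^k` (probability `≤ 1`);
* `exists_walk_apply_zero_le`, `exists_walk_le_apply_zero`, `nonIntersectingPairs_pos`,
  `nonIntersectingPairs_div_pos` — the straight walk to the left from `0` and the straight walk
  to the right from `e₁` never meet, so `N(k) ≥ 1` (probability `> 0`): the hypothesis
  `(h : LSW2001_srw_nonIntersection_five_eighths)` taken by the dependents is not vacuously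
  inconsistent at either end.

The exponent `5/8` itself (LSW 2001 Thm. 1/Thm. 13, `ξ(1,1) = 5/4`, via radial `SLE₆`, together
with Lawler 1996, EJP 1:13, Thm. 1.3, the random-walk estimate up to constants) is NOT proved here;
see the module docstring of `PlaneNonIntersection.lean` for the sources.

Design note (imports). This file imports nothing beyond `PlaneNonIntersection.lean`: the two
folklore inputs — the first-step recursion for counting walks in a regular locally finite graph
(`card_finsetWalkLength_succ`, `sum_card_finsetWalkLength_of_regular`; cf. the same recursion in
`Literature.Barriers.CriticalPhenomena.CTWSAW.sum_card_finsetWalkLength_eq`) and "a lattice step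
moves each coordinate by at most one" (`abs_sub_le_one_of_adj`, `abs_sub_le_length`; cf.
`Literature.Probability.RandomPlanarGeometry.SAW.Zd.abs_sub_le_length`) — are restated here in a
few lines rather than imported from those modules, which sit on top of the self-avoiding-walk /
`SLE` and weakly-SAW stacks; the `4`-regularity of `ℤ²` is the tree's
`Literature.Probability.LatticeModels.card_neighborFinset_zdGraph_holds`.

## References

* G. F. Lawler, O. Schramm, W. Werner, *Values of Brownian intersection exponents, II: Plane
  exponents*, Acta Math. **187** (2001) 275–308, §1 [LawlerSchrammWerner2001PlaneExponents].
* G. F. Lawler, *Cut times for simple random walk*, Electron. J. Probab. **1** (1996), paper 13,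
  Thm. 1.3 [Lawler1996CutTimes].

Tree: `zdGraph_adj_iff`, `mem_box`, `card_neighborFinset_zdGraph_holds` (`LatticeGraph.lean`,
`ThermodynamicLimit.lean`). Mathlib: `SimpleGraph.finsetWalkLength`,
`SimpleGraph.mem_finsetWalkLength_iff`, `Finset.single_le_sum`, `Finset.sum_mul_sum`,
`Finset.card_filter`, `Finset.sum_product`, `Finset.sum_sigma`, `Finset.sum_comm`.
-/

noncomputable section

open Finset SimpleGraph Literature.Probability.LatticeModels
open scoped BigOperators

namespace Literature.Probability.RandomPlanarGeometry

namespace PlaneNonIntersection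

/-! ### Counting walks in a locally finite graph: the first-step recursion -/

section WalkCount

variable {V : Type*} [DecidableEq V] (G : SimpleGraph V) [G.LocallyFinite]

/-- Zero-step walks: one from `u` to `u`, none to `v ≠ u`. [folklore] -/
theorem card_finsetWalkLength_zero (u v : V) :
    (G.finsetWalkLength 0 u v).card = if u = v then 1 else 0 := by
  split_ifs with h
  · subst h
    simp [SimpleGraph.finsetWalkLength]
  · simp [SimpleGraph.finsetWalkLength, h]

/-- First-step decomposition: the `n+1`-step walks from `u` to `v` are counted by summing the
`n`-step walks from the neighbours of `u` (Mathlib's recursive `finsetWalkLength`, whose branches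
are disjoint because they differ in the vertex at time `1`). [folklore] -/
theorem card_finsetWalkLength_succ (n : ℕ) (u v : V) :
    (G.finsetWalkLength (n + 1) u v).card =
      ∑ w ∈ G.neighborFinset u, (G.finsetWalkLength n w v).card := by
  have hdef : G.finsetWalkLength (n + 1) u v = Finset.univ.biUnion fun (w : G.neighborSet u) =>
      (G.finsetWalkLength n w v).map ⟨fun p => SimpleGraph.Walk.cons w.property p,
        fun _ _ => by simp⟩ := rfl
  rw [hdef, Finset.card_biUnion]
  · simp only [Finset.card_map]
    exact (Finset.sum_subtype (G.neighborFinset u) (fun w => G.mem_neighborFinset u w)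
      (fun w => (G.finsetWalkLength n w v).card)).symm
  · intro w₁ _ w₂ _ hne
    rw [Function.onFun, Finset.disjoint_left]
    intro p hp₁ hp₂
    rw [Finset.mem_map] at hp₁ hp₂
    obtain ⟨q₁, -, rfl⟩ := hp₁
    obtain ⟨q₂, -, hq⟩ := hp₂
    have h1 := congrArg (fun p : G.Walk u v => p.getVert 1) hq
    simp only [Function.Embedding.coeFn_mk, SimpleGraph.Walk.getVert_cons_succ,
      SimpleGraph.Walk.getVert_zero] at h1
    exact hne (Subtype.ext h1.symm)

/-- **A `D`-regular locally finite graph has exactly `D^n` walks of length `n` from each vertex**,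
counted over any finite set of endpoints containing all of them (induction on `n` by the
first-step recursion). [folklore] -/
theorem sum_card_finsetWalkLength_of_regular {D : ℕ} (hreg : ∀ v, (G.neighborFinset v).card = D)
    (n : ℕ) : ∀ (u : V) (X : Finset V), (∀ (x : V) (p : G.Walk u x), p.length = n → x ∈ X) →
      ∑ x ∈ X, (G.finsetWalkLength n u x).card = D ^ n := by
  induction n with
  | zero =>
    intro u X hX
    have hu : u ∈ X := hX u SimpleGraph.Walk.nil rfl
    simp only [card_finsetWalkLength_zero, pow_zero, Finset.sum_ite_eq, if_pos hu]
  | succ n ih =>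
    intro u X hX
    calc ∑ x ∈ X, (G.finsetWalkLength (n + 1) u x).card
        = ∑ w ∈ G.neighborFinset u, ∑ x ∈ X, (G.finsetWalkLength n w x).card := by
          simp_rw [card_finsetWalkLength_succ]; exact Finset.sum_comm
      _ = ∑ _w ∈ G.neighborFinset u, D ^ n := by
          refine Finset.sum_congr rfl fun w hw => ih w X fun x p hp => ?_
          exact hX x (SimpleGraph.Walk.cons ((G.mem_neighborFinset u w).1 hw) p)
            (by rw [SimpleGraph.Walk.length_cons, hp])
      _ = D ^ (n + 1) := by
          rw [Finset.sum_const, smul_eq_mul, hreg u]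
          ring

end WalkCount

/-! ### Coordinates of `e₁`; a lattice step moves each coordinate by at most one -/

/-- `e₁ = (1, 0)`: first coordinate. [folklore] -/
@[simp] theorem e₁_apply_zero : e₁ 0 = 1 := by simp [e₁]

/-- `e₁ = (1, 0)`: second coordinate. [folklore] -/
@[simp] theorem e₁_apply_one : e₁ 1 = 0 := by simp [e₁]

/-- `|e₁ i| ≤ 1` for both coordinates. [folklore] -/
theorem abs_e₁_apply_le (i : Fin 2) : |e₁ i| ≤ 1 := by
  fin_cases i <;> simp

/-- Adjacent sites of `ℤ²` differ by at most `1` in each coordinate (`zdGraph_adj_iff`: they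
differ by `± eⱼ`). [folklore] -/
theorem abs_sub_le_one_of_adj {x y : Site 2} (h : (zdGraph 2).Adj x y) (i : Fin 2) :
    |y i - x i| ≤ 1 := by
  obtain ⟨j, hj | hj⟩ := (zdGraph_adj_iff x y).1 h
  · rw [hj, Pi.add_apply, add_sub_cancel_left, Pi.single_apply]
    split_ifs <;> simp
  · rw [hj, Pi.add_apply, ← sub_sub, sub_self, zero_sub, abs_neg, Pi.single_apply]
    split_ifs <;> simp

/-- The endpoint of an `n`-step walk on `ℤ²` is within `ℓ^∞`-distance `n` of its start.
[folklore] -/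
theorem abs_sub_le_length {u x : Site 2} (p : (zdGraph 2).Walk u x) (i : Fin 2) :
    |x i - u i| ≤ p.length := by
  induction p with
  | nil => simp
  | cons h q ih =>
    rename_i a b c
    rw [SimpleGraph.Walk.length_cons, Nat.cast_succ]
    calc |c i - a i| = |(c i - b i) + (b i - a i)| := by ring_nf
      _ ≤ |c i - b i| + |b i - a i| := abs_add_le _ _
      _ ≤ q.length + 1 := add_le_add ih (abs_sub_le_one_of_adj h i)

/-! ### Endpoints: walks of length `≤ k` from `0` / `e₁` end in `box 2 k` / `box 2 (k + 1)` -/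

/-- A nearest-neighbour walk of length `≤ k` from the origin ends in the box `{-k,…,k}²`.
[folklore] -/
theorem mem_box_of_walk_origin {v : Site 2} (p : (zdGraph 2).Walk (0 : Site 2) v) {k : ℕ}
    (h : p.length ≤ k) : v ∈ box 2 k := by
  rw [mem_box]
  intro i
  have h1 := abs_sub_le_length p i
  have h2 : (p.length : ℤ) ≤ k := by exact_mod_cast h
  simp only [Pi.zero_apply, sub_zero] at h1
  exact abs_le.1 (h1.trans h2)

/-- A nearest-neighbour walk of length `≤ k` from `e₁ = (1,0)` ends in the box `{-(k+1),…,k+1}²`.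
[folklore] -/
theorem mem_box_of_walk_e₁ {w : Site 2} (q : (zdGraph 2).Walk e₁ w) {k : ℕ} (h : q.length ≤ k) :
    w ∈ box 2 (k + 1) := by
  rw [mem_box]
  intro i
  have h1 := abs_sub_le_length q i
  have h2 : (q.length : ℤ) ≤ k := by exact_mod_cast h
  have he := abs_e₁_apply_le i
  have hw : |w i| ≤ k + 1 :=
    calc |w i| = |(w i - e₁ i) + e₁ i| := by rw [sub_add_cancel]
      _ ≤ |w i - e₁ i| + |e₁ i| := abs_add_le _ _
      _ ≤ k + 1 := by linarith
  push_cast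
  exact ⟨by linarith [(abs_le.1 hw).1], (abs_le.1 hw).2⟩

/-! ### Counting: `4^k` walks from `0`, `4^k` walks from `e₁`, `16^k` pairs -/

/-- **There are `4^k` nearest-neighbour walks of length `k` from the origin of `ℤ²`**, all ending
in `box 2 k` (`4`-regularity, `card_neighborFinset_zdGraph_holds`, and the first-step recursion).
[folklore] -/
theorem sum_card_walks_from_origin (k : ℕ) :
    ∑ v ∈ box 2 k, ((zdGraph 2).finsetWalkLength k (0 : Site 2) v).card = 4 ^ k := by
  simpa using sum_card_finsetWalkLength_of_regular (zdGraph 2)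
    (card_neighborFinset_zdGraph_holds (d := 2)) k (0 : Site 2) (box 2 k)
    fun _ p hp => mem_box_of_walk_origin p hp.le

/-- **There are `4^k` nearest-neighbour walks of length `k` from `e₁`**, all ending in
`box 2 (k + 1)`. [folklore] -/
theorem sum_card_walks_from_e₁ (k : ℕ) :
    ∑ w ∈ box 2 (k + 1), ((zdGraph 2).finsetWalkLength k e₁ w).card = 4 ^ k := by
  simpa using sum_card_finsetWalkLength_of_regular (zdGraph 2)
    (card_neighborFinset_zdGraph_holds (d := 2)) k e₁ (box 2 (k + 1))
    fun _ q hq => mem_box_of_walk_e₁ q hq.le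

/-- **The number of ordered pairs `(ω, ω')` of `k`-step walks, `ω` from `0`, `ω'` from `e₁`, is
`16^k`**: the denominator of `nonIntersectingPairs k / 16^k` is the total mass of the uniform
(product simple-random-walk) law on pairs. [folklore] -/
theorem sum_card_pairs (k : ℕ) :
    ∑ v ∈ box 2 k, ∑ w ∈ box 2 (k + 1),
      ((zdGraph 2).finsetWalkLength k (0 : Site 2) v).card *
        ((zdGraph 2).finsetWalkLength k e₁ w).card = 16 ^ k := by
  rw [← Finset.sum_mul_sum, sum_card_walks_from_origin, sum_card_walks_from_e₁, ← mul_pow]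
  norm_num

/-! ### `N(k)` as the cardinality of a set of pairs -/

/-- **`N(k)` as a cardinality**: `nonIntersectingPairs k` is the number of ordered pairs
`((v, ω), (w, ω'))` — a `k`-step walk `ω : 0 → v` and a `k`-step walk `ω' : e₁ → w`, endpoints in
the exhaustive boxes — whose vertex sets are disjoint (LSW's event `S[0,k] ∩ S'[0,k] = ∅` counted
over the `16^k` equally likely pairs, `sum_card_pairs`). [folklore] -/
theorem nonIntersectingPairs_eq_card_filter (k : ℕ) :
    nonIntersectingPairs k =
      ((((box 2 k).sigma fun v => (zdGraph 2).finsetWalkLength k (0 : Site 2) v) ×ˢ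
          ((box 2 (k + 1)).sigma fun w => (zdGraph 2).finsetWalkLength k e₁ w)).filter
        fun pq => Disjoint pq.1.2.support.toFinset pq.2.2.support.toFinset).card := by
  unfold nonIntersectingPairs
  rw [Finset.card_filter, Finset.sum_product, Finset.sum_sigma]
  refine Finset.sum_congr rfl fun v _ => ?_
  simp_rw [Finset.sum_sigma]
  exact Finset.sum_comm

/-! ### The upper bound `N(k) ≤ 16^k` -/

/-- A double sum of terms `≤ 1` is at most the product of the cardinalities. [folklore] -/
theorem sum_sum_le_card_mul {α β : Type*} (s : Finset α) (t : Finset β) (f : α → β → ℕ)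
    (hf : ∀ a b, f a b ≤ 1) : ∑ a ∈ s, ∑ b ∈ t, f a b ≤ s.card * t.card :=
  calc ∑ a ∈ s, ∑ b ∈ t, f a b ≤ ∑ a ∈ s, ∑ _b ∈ t, 1 :=
      Finset.sum_le_sum fun a _ => Finset.sum_le_sum fun b _ => hf a b
    _ = s.card * t.card := by simp

/-- **`N(k) ≤ 16^k`**: the number of non-intersecting pairs is at most the number of pairs.
[folklore] -/
theorem nonIntersectingPairs_le (k : ℕ) : nonIntersectingPairs k ≤ 16 ^ k := by
  rw [← sum_card_pairs k]
  unfold nonIntersectingPairs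
  refine Finset.sum_le_sum fun v _ => Finset.sum_le_sum fun w _ => ?_
  exact sum_sum_le_card_mul _ _ _ fun a b => by split_ifs <;> simp

/-- **`N(k) / 16^k ≤ 1`**: the vendored non-intersection probability is at most `1`. [folklore] -/
theorem nonIntersectingPairs_div_le_one (k : ℕ) : (nonIntersectingPairs k : ℝ) / 16 ^ k ≤ 1 := by
  rw [div_le_one (by positivity)]
  exact_mod_cast nonIntersectingPairs_le k

/-! ### The lower bound `N(k) ≥ 1`: straight walks in opposite directions -/

/-- **The straight walk to the left**: from every site `a` of `ℤ²` there is a `k`-step walk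
(`a, a - e₁, a - 2e₁, …`) all of whose sites have first coordinate `≤ a 0`. [folklore] -/
theorem exists_walk_apply_zero_le (k : ℕ) :
    ∀ a : Site 2, ∃ (b : Site 2) (p : (zdGraph 2).Walk a b),
      p.length = k ∧ ∀ x ∈ p.support, x 0 ≤ a 0 := by
  induction k with
  | zero => exact fun a => ⟨a, Walk.nil, rfl, by simp⟩
  | succ k ih =>
    intro a
    obtain ⟨b, p, hp, hs⟩ := ih (a - Pi.single 0 1)
    have hadj : (zdGraph 2).Adj a (a - Pi.single 0 1) :=
      (zdGraph_adj_iff _ _).2 ⟨0, Or.inr (sub_add_cancel a _).symm⟩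
    refine ⟨b, Walk.cons hadj p, by rw [Walk.length_cons, hp], fun x hx => ?_⟩
    rw [Walk.support_cons, List.mem_cons] at hx
    rcases hx with rfl | hx
    · exact le_rfl
    · have h := hs x hx
      simp only [Pi.sub_apply, Pi.single_eq_same] at h
      linarith

/-- **The straight walk to the right**: from every site `a` of `ℤ²` there is a `k`-step walk
(`a, a + e₁, a + 2e₁, …`) all of whose sites have first coordinate `≥ a 0`. [folklore] -/
theorem exists_walk_le_apply_zero (k : ℕ) :
    ∀ a : Site 2, ∃ (b : Site 2) (p : (zdGraph 2).Walk a b),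
      p.length = k ∧ ∀ x ∈ p.support, a 0 ≤ x 0 := by
  induction k with
  | zero => exact fun a => ⟨a, Walk.nil, rfl, by simp⟩
  | succ k ih =>
    intro a
    obtain ⟨b, p, hp, hs⟩ := ih (a + Pi.single 0 1)
    have hadj : (zdGraph 2).Adj a (a + Pi.single 0 1) := (zdGraph_adj_iff _ _).2 ⟨0, Or.inl rfl⟩
    refine ⟨b, Walk.cons hadj p, by rw [Walk.length_cons, hp], fun x hx => ?_⟩
    rw [Walk.support_cons, List.mem_cons] at hx
    rcases hx with rfl | hx
    · exact le_rfl
    · have h := hs x hx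
      simp only [Pi.add_apply, Pi.single_eq_same] at h
      linarith

/-- **`N(k) ≥ 1`**: the straight walk to the left from `0` and the straight walk to the right from
`e₁` have disjoint vertex sets (first coordinates `≤ 0`, resp. `≥ 1`), so at least one ordered
pair of `k`-step walks is non-intersecting. [folklore] -/
theorem nonIntersectingPairs_pos (k : ℕ) : 0 < nonIntersectingPairs k := by
  obtain ⟨v, p, hp, hps⟩ := exists_walk_apply_zero_le k (0 : Site 2)
  obtain ⟨w, q, hq, hqs⟩ := exists_walk_le_apply_zero k e₁
  have hv : v ∈ box 2 k := mem_box_of_walk_origin p hp.le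
  have hw : w ∈ box 2 (k + 1) := mem_box_of_walk_e₁ q hq.le
  have hdisj : Disjoint p.support.toFinset q.support.toFinset := by
    rw [Finset.disjoint_left]
    intro x hxp hxq
    have h1 := hps x (List.mem_toFinset.1 hxp)
    have h2 := hqs x (List.mem_toFinset.1 hxq)
    simp only [Pi.zero_apply] at h1
    simp only [e₁_apply_zero] at h2
    linarith
  unfold nonIntersectingPairs
  have hpm : p ∈ (zdGraph 2).finsetWalkLength k (0 : Site 2) v := mem_finsetWalkLength_iff.2 hp
  have hqm : q ∈ (zdGraph 2).finsetWalkLength k e₁ w := mem_finsetWalkLength_iff.2 hq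
  refine lt_of_lt_of_le ?_ (Finset.single_le_sum (fun _ _ => Nat.zero_le _) hv)
  refine lt_of_lt_of_le ?_ (Finset.single_le_sum (fun _ _ => Nat.zero_le _) hw)
  refine lt_of_lt_of_le ?_ (Finset.single_le_sum (fun _ _ => Nat.zero_le _) hpm)
  refine lt_of_lt_of_le ?_ (Finset.single_le_sum (fun _ _ => Nat.zero_le _) hqm)
  simp [hdisj]

/-- **`0 < N(k) / 16^k`**: the vendored non-intersection probability is positive for every `k`.
[folklore] -/
theorem nonIntersectingPairs_div_pos (k : ℕ) : 0 < (nonIntersectingPairs k : ℝ) / 16 ^ k := by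
  have h : (0 : ℝ) < nonIntersectingPairs k := by exact_mod_cast nonIntersectingPairs_pos k
  positivity

end PlaneNonIntersection

end Literature.Probability.RandomPlanarGeometry

end
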